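import Summits.Ventures.GridStability.Models.SMIBEnergyRoa

/-!
# GridStability/Models/AngleEnclosure — certified rational enclosures of equilibrium angles from their exact circle points

Cell `gridfusion` (LADDER-GRIDFUSION G1/G2.b energy route and every -roa «angle recovery»), seat
gridfusion-model-1, `plan/PARTITION.md` A1/A1″ (equilibrium angles are represented by EXACT rational
circle points `(s, c)`, `s² + c² = 1`, half-angle `t ∈ ℚ`; the angle itself `x = arcsin s = 2 arctan t`
is irrational). Whenever a kernel statement needs the ANGLE (critical energies `V_cr(δˢ)` contain
`π − 2δˢ`; window / phase-cohesiveness hypotheses `|δᵢ − δⱼ| ≤ θ < π/2`; lyap-1's `levelBound θ β`),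
a certified two-sided RATIONAL enclosure `q₁ < x < q₂` is required. This file supplies it generically,
by elementary means available in Mathlib (no interval-arithmetic library; the file imports `SMIBEnergyRoa`
only to reuse its doubling lemma — the pattern first used there for `deltaK13_gt`):

* `SMIB.cos_two_mul_ge` (p479609, reused) / `cos_two_mul_le'` — angle doubling transports lower / upper cosine bounds
  (`0 ≤ l ≤ cos y ⇒ 2l² − 1 ≤ cos 2y`; `0 ≤ cos y ≤ u ⇒ cos 2y ≤ 2u² − 1`);
* `cosLower4 q` / `cosLower4_le_cos` — `1 − y²/2 ≤ cos y` at `y = q/16`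
  (`Real.one_sub_sq_div_two_le_cos`) followed by four doublings: an explicit polynomial lower bound
  `cosLower4 q ≤ cos q`, valid whenever the intermediate values are nonnegative (decidable
  rational side conditions; they hold for `0 ≤ q ≤ 2.2`); `cosLower5` = the same from `q/32` with
  five doublings (≈ 4× tighter);
* `cosUpper4 q` / `cos_le_cosUpper4` — `cos y ≤ 1 − y²/2 + (5/96) y⁴` at `y = q/16`
  (`Real.cos_bound`, `|y| ≤ 1`) followed by four doublings (needs `cos (q/2^k) ≥ 0`, i.e. `0 ≤ q ≤ π`);
* `lt_of_cos_lt` / `lt_of_lt_cos` — for `x, q ∈ [0, π]`: `cos x < cosLower4 q ⇒ x > q`… precisely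
  `cos x < cos q ⇒ q < x` packaged with the chains: `angle_gt_of_chain(5)`, `angle_lt_of_chain`;
* `arcsin_gt_of_chain(5)` / `arcsin_lt_of_chain` — the A1″ use case: `x = arcsin s` with
  `cos x = c` (`c = √(1 − s²)` rational by construction): rational inequalities
  `c < cosLower4 q₁`, `cosUpper4 q₂ < c` (closed by `norm_num` per instance) give `q₁ < arcsin s < q₂`.

Accuracy at `q ≈ 1`: `cosLower4` loses ≈ 1.2·10⁻⁴ in `cos`, `cosLower5` ≈ 3·10⁻⁵, `cosUpper4`
≈ 3·10⁻⁵ — the worked example below encloses `δˢ` of «SMIB-K13post-D10» to width `10⁻⁴ rad`. Instance of the pattern already in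
the tree: `SMIB.deltaK13_gt` (p479609). CERTIFIED/VALIDATED/MODELLED: pure mathematics (tooling for
the MODELLED-column angle statements); no model content.
-/

noncomputable section

open Real Set

namespace Summit.Ventures.GridStability.Models.AngleEnclosure

-- Doubling a cosine LOWER bound `0 ≤ l ≤ cos y ⇒ 2l² − 1 ≤ cos (2y)` is `SMIB.cos_two_mul_ge`
-- (SMIBEnergyRoa.lean, p479609), reused here.

/-- Doubling a cosine UPPER bound: `0 ≤ cos y ≤ u ⇒ cos (2y) ≤ 2u² − 1`. -/
theorem cos_two_mul_le' {y u : ℝ} (hc : 0 ≤ cos y) (h : cos y ≤ u) : cos (2 * y) ≤ 2 * u ^ 2 - 1 := by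
  rw [cos_two_mul]; nlinarith [pow_le_pow_left₀ hc h 2]

/-- One doubling step of the explicit bound polynomials. -/
def dbl (v : ℝ) : ℝ := 2 * v ^ 2 - 1

/-- Explicit LOWER bound for `cos q`: `1 − (q/16)²/2` doubled four times. -/
def cosLower4 (q : ℝ) : ℝ := dbl (dbl (dbl (dbl (1 - (q / 16) ^ 2 / 2))))

/-- Explicit UPPER bound for `cos q`: `1 − (q/16)²/2 + (5/96)(q/16)⁴` doubled four times. -/
def cosUpper4 (q : ℝ) : ℝ := dbl (dbl (dbl (dbl (1 - (q / 16) ^ 2 / 2 + (5 / 96) * (q / 16) ^ 4))))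

/-- **Lower chain.** If the three intermediate doubled values are nonnegative (rational side
conditions, true for `0 ≤ q ≤ 2.2`), then `cosLower4 q ≤ cos q`. -/
theorem cosLower4_le_cos (q : ℝ) (h0 : 0 ≤ 1 - (q / 16) ^ 2 / 2)
    (h1 : 0 ≤ dbl (1 - (q / 16) ^ 2 / 2)) (h2 : 0 ≤ dbl (dbl (1 - (q / 16) ^ 2 / 2)))
    (h3 : 0 ≤ dbl (dbl (dbl (1 - (q / 16) ^ 2 / 2)))) : cosLower4 q ≤ cos q := by
  have hq : q = 2 * (2 * (2 * (2 * (q / 16)))) := by ring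
  have c0 : 1 - (q / 16) ^ 2 / 2 ≤ cos (q / 16) := one_sub_sq_div_two_le_cos
  have c1 := SMIB.cos_two_mul_ge h0 c0
  have c2 := SMIB.cos_two_mul_ge h1 c1
  have c3 := SMIB.cos_two_mul_ge h2 c2
  have c4 := SMIB.cos_two_mul_ge h3 c3
  rw [← hq] at c4
  exact c4

/-- Finer explicit LOWER bound for `cos q`: `1 − (q/32)²/2` doubled five times. -/
def cosLower5 (q : ℝ) : ℝ := dbl (dbl (dbl (dbl (dbl (1 - (q / 32) ^ 2 / 2)))))

/-- **Lower chain, five doublings** (loses ≈ 4× less than `cosLower4`). -/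
theorem cosLower5_le_cos (q : ℝ) (h0 : 0 ≤ 1 - (q / 32) ^ 2 / 2)
    (h1 : 0 ≤ dbl (1 - (q / 32) ^ 2 / 2)) (h2 : 0 ≤ dbl (dbl (1 - (q / 32) ^ 2 / 2)))
    (h3 : 0 ≤ dbl (dbl (dbl (1 - (q / 32) ^ 2 / 2))))
    (h4 : 0 ≤ dbl (dbl (dbl (dbl (1 - (q / 32) ^ 2 / 2))))) : cosLower5 q ≤ cos q := by
  have hq : q = 2 * (2 * (2 * (2 * (2 * (q / 32))))) := by ring
  have c0 : 1 - (q / 32) ^ 2 / 2 ≤ cos (q / 32) := one_sub_sq_div_two_le_cos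
  have c1 := SMIB.cos_two_mul_ge h0 c0
  have c2 := SMIB.cos_two_mul_ge h1 c1
  have c3 := SMIB.cos_two_mul_ge h2 c2
  have c4 := SMIB.cos_two_mul_ge h3 c3
  have c5 := SMIB.cos_two_mul_ge h4 c4
  rw [← hq] at c5
  exact c5

/-- `cos` is nonnegative at `q/2^k` for `0 ≤ q ≤ π`, `k ≥ 1`. -/
theorem cos_nonneg_of_le_pi_div {q : ℝ} (h0 : 0 ≤ q) (hπ : q ≤ π) {d : ℝ} (hd : 2 ≤ d) :
    0 ≤ cos (q / d) := by
  have hdpos : 0 < d := by linarith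
  apply cos_nonneg_of_neg_pi_div_two_le_of_le
  · have : 0 ≤ q / d := div_nonneg h0 hdpos.le
    linarith [pi_pos]
  · rw [div_le_iff₀ hdpos]
    nlinarith [pi_pos]

/-- **Upper chain.** For `0 ≤ q ≤ π`: `cos q ≤ cosUpper4 q` (Taylor remainder `Real.cos_bound` at
`q/16`, `|q/16| ≤ 1`, then four doublings using `cos (q/2^k) ≥ 0`). -/
theorem cos_le_cosUpper4 {q : ℝ} (h0 : 0 ≤ q) (hπ : q ≤ π) : cos q ≤ cosUpper4 q := by
  have hq : q = 2 * (2 * (2 * (2 * (q / 16)))) := by ring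
  have hy : |q / 16| ≤ 1 := by
    rw [abs_of_nonneg (by positivity)]
    linarith [pi_lt_four]
  have hb := Real.cos_bound hy
  have c0 : cos (q / 16) ≤ 1 - (q / 16) ^ 2 / 2 + (5 / 96) * (q / 16) ^ 4 := by
    have := (abs_le.1 hb).2
    rw [abs_of_nonneg (by positivity : (0:ℝ) ≤ q / 16)] at this
    linarith
  have n0 : 0 ≤ cos (q / 16) := cos_nonneg_of_le_pi_div h0 hπ (by norm_num)
  have n1 : 0 ≤ cos (2 * (q / 16)) := by
    rw [show 2 * (q / 16) = q / 8 by ring]; exact cos_nonneg_of_le_pi_div h0 hπ (by norm_num)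
  have n2 : 0 ≤ cos (2 * (2 * (q / 16))) := by
    rw [show 2 * (2 * (q / 16)) = q / 4 by ring]; exact cos_nonneg_of_le_pi_div h0 hπ (by norm_num)
  have n3 : 0 ≤ cos (2 * (2 * (2 * (q / 16)))) := by
    rw [show 2 * (2 * (2 * (q / 16))) = q / 2 by ring]
    exact cos_nonneg_of_le_pi_div h0 hπ (by norm_num)
  have c1 := cos_two_mul_le' n0 c0
  have c2 := cos_two_mul_le' n1 c1
  have c3 := cos_two_mul_le' n2 c2
  have c4 := cos_two_mul_le' n3 c3
  rw [← hq] at c4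
  exact c4

/-- Strict anti-monotonicity of `cos` on `[0, π]`, contrapositive form: `cos x < cos q ⇒ q < x`. -/
theorem lt_of_cos_lt {x q : ℝ} (hx0 : 0 ≤ x) (hqπ : q ≤ π) (h : cos x < cos q) : q < x := by
  by_contra hle
  have hle := not_lt.1 hle
  rcases hle.lt_or_eq with hlt | heq
  · have := Real.cos_lt_cos_of_nonneg_of_le_pi hx0 hqπ hlt
    linarith
  · rw [heq] at h; exact lt_irrefl _ h

/-- **Certified LOWER bound of an angle from its cosine.** `0 ≤ x`, `q ≤ π`, the lower-chain side
conditions at `q`, and `cos x < cosLower4 q` give `q < x`. -/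
theorem angle_gt_of_chain {x q : ℝ} (hx0 : 0 ≤ x) (hqπ : q ≤ π)
    (h0 : 0 ≤ 1 - (q / 16) ^ 2 / 2) (h1 : 0 ≤ dbl (1 - (q / 16) ^ 2 / 2))
    (h2 : 0 ≤ dbl (dbl (1 - (q / 16) ^ 2 / 2))) (h3 : 0 ≤ dbl (dbl (dbl (1 - (q / 16) ^ 2 / 2))))
    (h : cos x < cosLower4 q) : q < x :=
  lt_of_cos_lt hx0 hqπ (h.trans_le (cosLower4_le_cos q h0 h1 h2 h3))

/-- **Certified LOWER bound of an angle from its cosine, five-doubling chain.** -/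
theorem angle_gt_of_chain5 {x q : ℝ} (hx0 : 0 ≤ x) (hqπ : q ≤ π)
    (h0 : 0 ≤ 1 - (q / 32) ^ 2 / 2) (h1 : 0 ≤ dbl (1 - (q / 32) ^ 2 / 2))
    (h2 : 0 ≤ dbl (dbl (1 - (q / 32) ^ 2 / 2))) (h3 : 0 ≤ dbl (dbl (dbl (1 - (q / 32) ^ 2 / 2))))
    (h4 : 0 ≤ dbl (dbl (dbl (dbl (1 - (q / 32) ^ 2 / 2)))))
    (h : cos x < cosLower5 q) : q < x :=
  lt_of_cos_lt hx0 hqπ (h.trans_le (cosLower5_le_cos q h0 h1 h2 h3 h4))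

/-- **Certified UPPER bound of an angle from its cosine.** `x ≤ π`, `0 ≤ q ≤ π` and
`cosUpper4 q < cos x` give `x < q`. -/
theorem angle_lt_of_chain {x q : ℝ} (hxπ : x ≤ π) (hq0 : 0 ≤ q) (hqπ : q ≤ π)
    (h : cosUpper4 q < cos x) : x < q :=
  lt_of_cos_lt hq0 hxπ ((cos_le_cosUpper4 hq0 hqπ).trans_lt h)

/-- **A1″ use case, lower side.** For an exact circle point with `cos (arcsin s) = c` (i.e. `c = √(1−s²)`,
rational by construction), `0 ≤ s`, a rational candidate `q ≤ π` passing the side conditions and the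
rational test `c < cosLower4 q`: `q < arcsin s`. All hypotheses except `hc` are closed by `norm_num`
per instance. -/
theorem arcsin_gt_of_chain {s c q : ℝ} (hc : cos (arcsin s) = c) (hs : 0 ≤ s) (hqπ : q ≤ π)
    (h0 : 0 ≤ 1 - (q / 16) ^ 2 / 2) (h1 : 0 ≤ dbl (1 - (q / 16) ^ 2 / 2))
    (h2 : 0 ≤ dbl (dbl (1 - (q / 16) ^ 2 / 2))) (h3 : 0 ≤ dbl (dbl (dbl (1 - (q / 16) ^ 2 / 2))))
    (h : c < cosLower4 q) : q < arcsin s :=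
  angle_gt_of_chain (arcsin_nonneg.2 hs) hqπ h0 h1 h2 h3 (by rwa [hc])

/-- **A1″ use case, lower side, five-doubling chain.** -/
theorem arcsin_gt_of_chain5 {s c q : ℝ} (hc : cos (arcsin s) = c) (hs : 0 ≤ s) (hqπ : q ≤ π)
    (h0 : 0 ≤ 1 - (q / 32) ^ 2 / 2) (h1 : 0 ≤ dbl (1 - (q / 32) ^ 2 / 2))
    (h2 : 0 ≤ dbl (dbl (1 - (q / 32) ^ 2 / 2))) (h3 : 0 ≤ dbl (dbl (dbl (1 - (q / 32) ^ 2 / 2))))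
    (h4 : 0 ≤ dbl (dbl (dbl (dbl (1 - (q / 32) ^ 2 / 2)))))
    (h : c < cosLower5 q) : q < arcsin s :=
  angle_gt_of_chain5 (arcsin_nonneg.2 hs) hqπ h0 h1 h2 h3 h4 (by rwa [hc])

/-- **A1″ use case, upper side.** `cos (arcsin s) = c`, `0 ≤ q ≤ π`, and the rational test
`cosUpper4 q < c` give `arcsin s < q`. -/
theorem arcsin_lt_of_chain {s c q : ℝ} (hc : cos (arcsin s) = c) (hq0 : 0 ≤ q) (hqπ : q ≤ π)
    (h : cosUpper4 q < c) : arcsin s < q :=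
  angle_lt_of_chain ((arcsin_le_pi_div_two s).trans (by linarith [pi_pos])) hq0 hqπ (by rwa [hc])

/-- Worked check of the pattern on the instance of record «SMIB-K13post-D10»
(`s* = 2899575/3551657`, `c* = 2051032/3551657`, `δˢ = arcsin s* = 0.9551504…`):
`0.9551 < δˢ < 0.9552` — width `10⁻⁴ rad`, all side goals closed by `norm_num`. -/
example (h : cos (arcsin (2899575 / 3551657 : ℝ)) = 2051032 / 3551657) :
    (9551 / 10000 : ℝ) < arcsin (2899575 / 3551657) ∧
      arcsin (2899575 / 3551657 : ℝ) < 9552 / 10000 := by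
  constructor
  · refine arcsin_gt_of_chain5 h (by norm_num) (by linarith [pi_gt_three]) ?_ ?_ ?_ ?_ ?_ ?_ <;>
      norm_num [dbl, cosLower5]
  · refine arcsin_lt_of_chain h (by norm_num) (by linarith [pi_gt_three]) ?_
    norm_num [dbl, cosUpper4]

end Summit.Ventures.GridStability.Models.AngleEnclosure

end
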